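import Literature.Geometry.Kaehler.ComplexTorusTranscendentalLatticeDualQuotients
import Literature.Geometry.Kaehler.ComplexTorusHodgeClassesPerfectPairing
import HarnessLib

/-!
# On a polarised torus the Hodge lattice and the transcendental lattice of the same even degree split
# `Hˡ(X, ℤ)` up to finite index: `Hdg^{l,q}(X, ℤ) ∩ T^l = 0`, `rk Hdg^{l,q}(X, ℤ) + rk T^l = b_l(X)`,
# `Hˡ(X, ℚ) = B^{l,q}(X) ⊕ ℚ·T^l`, and `[Hˡ(X, ℤ) : Hdg^{l,q}(X, ℤ) ⊕ T^l] = |det (⟨sᵢ, tⱼ⟩)|`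

Layer `Literature/Geometry/Kaehler`, namespace `Literature.Geometry.Kaehler.ComplexTorus`; lane `lit-hodgefound` (Track 2
foundations library), seat p09, generation 34, row g34-#1. THEOREMS ONLY (0 definitions); no named fact, net debt 0. Sequel of
g31-#11 `ComplexTorusTranscendentalLatticeAllDegrees` (the degree-`l` transcendental lattice

  `T^l = Hˡ(X, ℤ) ∩ ⋂_{s ∈ Hdg^{k,p}(X, ℤ)} ker ⟨s, ·⟩ = integralForms Φ l ⊓ ⨅ s, (ker (poincarePairing Φ e h s)).toAddSubgroup`, `k + l = 2g`,

written out exactly as there, no definition; `rk T^l = C(2g, l) − rk Hdg^{k,p}(X, ℤ)`), of g32-#4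
`ComplexTorusTranscendentalLatticeDualQuotients` (the restriction `r : Hˡ(X, ℤ) ↠ Hom(Hdg^{k,p}(X, ℤ), ℤ)`, `x ↦ ⟨·, x⟩`, is ONTO
with kernel `T^l`) and of `ComplexTorusHodgeClassesPerfectPairing` (BFNP 2009 (6.1): on a POLARISED torus of dimension `g` the cup
product `Bᵖ(X) × B^q(X) → ℚ`, `p + q = g`, is a perfect pairing of the `ℚ`-spaces of Hodge classes). Those files compare the Hodge
lattice of degree `k = 2p` with the transcendental lattice of the COMPLEMENTARY degree `l = 2q`; in the middle degree `k = l`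
(`g = 2p`) rows g30-#4/#10 (`ComplexTorusMiddleHodgeLatticeDiscriminant`, `…GlueGroup`) prove that `Hdg ⊕ T ⊂ H^{2p}(X, ℤ)` has
finite index `|disc Hdg|` on an abelian variety (Shioda–Mitani's "`|det S_X| = det T_X`" at `g = 2`). This file gives the
statement in EVERY even degree `l = 2q` of a polarised torus, comparing `T^l` with the Hodge lattice `Hdg^{l,q}(X, ℤ)` of the SAME
degree:

* §1 **`Hdg^{l,q}(X, ℤ) ∩ T^l = 0`** and `B^{l,q}(X) ∩ ℚ·T^l = 0`: a Hodge class of degree `2q` orthogonal to every integral Hodge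
  class of degree `2p` pairs to zero with all of `Bᵖ(X) = ℚ · Hdgᵖ(X, ℤ)`, hence vanishes by the perfectness of `Bᵖ × B^q → ℚ`
  (`IsRiemannForm.exists_mem_hodgeClasses_torusIntegral_wedge_ne_zero'`).
* §2 **`rk_ℤ Hdg^{l,q}(X, ℤ) + rk_ℤ T^l = C(2g, l) = b_l(X)`** (`rk T^l = C(2g, l) − rk Hdg^{k,p}` by g31-#11 and
  `rk Hdg^{k,p} = rk Hdg^{l,q}` by hard Lefschetz, the tree's `IsRiemannForm.finrank_integralHodgeClasses_eq_of_add_eq`, g31-#5), and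
  **`Hˡ(X, ℚ) = B^{l,q}(X) ⊕ ℚ·T^l`** (the two `ℚ`-spaces meet in `0` and their dimensions add up to `b_l`).
* §3 **`[Hˡ(X, ℤ) : Hdg^{l,q}(X, ℤ) ⊕ T^l] = |det M|`** for `ℤ`-bases `(sᵢ)` of `Hdg^{k,p}(X, ℤ)` and `(tⱼ)` of `Hdg^{l,q}(X, ℤ)`
  indexed by one finite type and the integer matrix `M i j = ⟨sᵢ, tⱼ⟩` (Huybrechts Ch. 14 (0.1)–(0.2): "`Λ₁ ⊕ Λ₂ ⊂ Λ` … of finite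
  index", "the canonical maps `Λ^* → Λᵢ^*` are surjective"): under g32-#4's surjection `r : Hˡ(X, ℤ) ↠ Hom(Hdg^{k,p}(X, ℤ), ℤ)`
  with kernel `T^l` the subgroup `Hdg^{l,q} ⊕ T^l` is the preimage of `r(Hdg^{l,q})`, whose index in the dual lattice is the
  determinant of the pairing matrix in the dual basis (Mathlib's `AddSubgroup.index_eq_natAbs_det`); `det M ≠ 0` by §1, so
  **the index is finite and non-zero** and `Hˡ(X, ℚ) = B^{l,q}(X) ⊕ ℚ·T^l`.

Throughout `X = E/Φ(ℤ^ι)` carries a Riemann form `η` (`IsRiemannForm Φ η`: a polarised torus = abelian variety), `e : Fin (2g) ≃ ι`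
orders the lattice basis (`g = dim_ℂ X`), `k = 2p`, `l = 2q`, `hpq : p + q = g`, `h : 2p + 2q = 2g` is the degree bookkeeping of
`poincarePairing Φ e h : H^{2p}(X, ℂ) × H^{2q}(X, ℂ) → ℂ` (`⟨γ, δ⟩_e = sign(e) ∫_X γ ∧ δ`), `Hdg^{m,r}(X, ℤ) = integralHodgeClassesIn Φ m r`,
`B^{m,r}(X) = hodgeClassesIn Φ m r` (`= hodgeClasses Φ r` for `m = 2r`).

## References

* [cite: BrosnanFangNiePearlstein2009, §6 (6.1) and the sentence following it]
* [cite: Huybrechts2016K3, Ch. 14 §0.1–0.2 (PDF pp. 333–334: (0.1) finite-index sublattices, "`Λ₁ ⊕ Λ₂ ⊂ Λ`", "`Λ^* → Λᵢ^*` surjective"); Ch. 3 §2.2–2.3, Lemma 3.1]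
* [cite: ShiodaMitani1974, §1 (1.5) and §4 p. 172 ("`|det S_X| = det T_X`")]
* [cite: Lange2023AbelianVarietiesComplex, §6.2.4 (p. 310: Poincaré duality over `ℤ`); §7.2.2; §7.3.2 (1); §1.1.3 Exercise 1.1.6 (8)]
* [cite: VoisinHodgeI2002, §7.1.2 and Lemma 7.26 (PDF p. 148)]
-/

noncomputable section

open Module Function

namespace Literature.Geometry.Kaehler.ComplexTorus

section PolarizedSplitting

variable {ι : Type*} [Fintype ι] [DecidableEq ι] {E : Type*} [NormedAddCommGroup E] [NormedSpace ℂ E]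
  (Φ : (ι → ℝ) ≃L[ℝ] E) {g p q : ℕ} (e : Fin (2 * g) ≃ ι) (hpq : p + q = g) (h : 2 * p + 2 * q = 2 * g)
  {η : E [⋀^Fin 2]→L[ℝ] ℝ}

include hpq

/-! ## §1 `Hdg^{l,q}(X, ℤ) ∩ T^l = 0` on a polarised torus -/

/-- **A Hodge class of degree `2q` orthogonal to all integral Hodge classes of the complementary degree `2p` is zero** on a
polarised torus (`p + q = g`): `⟨s, y⟩ = 0` for all `s ∈ Hdgᵖ(X, ℤ)` forces `⟨x, y⟩ = 0` on `Bᵖ(X) = ℚ · Hdgᵖ(X, ℤ)`, and the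
cup product `Bᵖ × B^q → ℚ` is perfect. [cite: BrosnanFangNiePearlstein2009, §6 (6.1)] [cite: VoisinHodgeI2002, §7.2 Lemma 7.26 (proof, PDF p. 148)] -/
theorem IsRiemannForm.eq_zero_of_mem_hodgeClassesIn_of_forall_poincarePairing_eq_zero (hη : IsRiemannForm Φ η)
    {y : E [⋀^Fin (2 * q)]→L[ℝ] ℂ} (hy : y ∈ hodgeClassesIn Φ (2 * q) q)
    (h0 : ∀ s ∈ integralHodgeClassesIn Φ (2 * p) p, poincarePairing Φ e h s y = 0) : y = 0 := by
  classical
  letI : LinearOrder ι := LinearOrder.lift' (Fintype.equivFin ι) (Fintype.equivFin ι).injective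
  haveI := finiteDimensional_real Φ e
  haveI : FiniteDimensional ℂ E := Module.Finite.of_restrictScalars_finite ℝ ℂ E
  -- `⟨x, y⟩ = 0` for every RATIONAL Hodge class `x ∈ Bᵖ(X) = ℚ · Hdgᵖ(X, ℤ)`
  have key : ∀ x ∈ Submodule.span ℚ (integralHodgeClassesIn Φ (2 * p) p : Set (E [⋀^Fin (2 * p)]→L[ℝ] ℂ)),
      poincarePairing Φ e h x y = 0 := by
    intro x hx
    induction hx using Submodule.span_induction with
    | mem s hs => exact h0 s hs
    | zero => rw [map_zero, LinearMap.zero_apply]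
    | add s t _ _ ihs iht => rw [map_add, LinearMap.add_apply, ihs, iht, add_zero]
    | smul c s _ ih => rw [← Rat.cast_smul_eq_qsmul ℂ c, map_smul, LinearMap.smul_apply, ih, smul_zero]
  by_contra hy0
  obtain ⟨x, hx, hI⟩ := hη.exists_mem_hodgeClasses_torusIntegral_wedge_ne_zero' Φ e hpq h hy hy0
  have hx' : x ∈ hodgeClassesIn Φ (2 * p) p := hx
  rw [hodgeClassesIn_eq_span_integralHodgeClassesIn] at hx'
  have hx0 := key x hx'
  rw [poincarePairing_eq_orientationSign_mul_torusIntegral_wedge, torusIntegral_finCongr_trans] at hx0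
  have hsign : (orientationSign Φ ((finCongr h).trans e) : ℂ) ≠ 0 := by
    rcases orientationSign_eq_or Φ ((finCongr h).trans e) with hs | hs <;> rw [hs] <;> norm_num
  exact hI ((mul_eq_zero.1 hx0).resolve_left hsign)

/-- **`Hdg^{l,q}(X, ℤ) ∩ T^l = 0`** (`l = 2q`, `T^l` the annihilator of `Hdgᵖ(X, ℤ) ⊂ H^{2p}(X, ℤ)`, `p + q = g`) on a polarised
torus: the Hodge lattice and the transcendental lattice of the same even degree meet trivially.
[cite: BrosnanFangNiePearlstein2009, §6 (6.1)] [cite: Huybrechts2016K3, Ch. 3 Lemma 3.1 (PDF p. 63: "`NS(X)` non-degenerate … `NS ∩ T = 0`")] -/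
theorem IsRiemannForm.integralHodgeClassesIn_inf_integralHodgeAnnihilator_eq_bot (hη : IsRiemannForm Φ η) :
    integralHodgeClassesIn Φ (2 * q) q ⊓ (integralForms Φ (2 * q) ⊓ ⨅ s : integralHodgeClassesIn Φ (2 * p) p,
        (LinearMap.ker (poincarePairing Φ e h (s : E [⋀^Fin (2 * p)]→L[ℝ] ℂ))).toAddSubgroup) = ⊥ := by
  refine (AddSubgroup.eq_bot_iff_forall _).2 fun y hy ↦ ?_
  rw [AddSubgroup.mem_inf, mem_integralHodgeAnnihilator_iff] at hy
  exact hη.eq_zero_of_mem_hodgeClassesIn_of_forall_poincarePairing_eq_zero Φ e hpq h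
    (integralHodgeClassesIn_subset_hodgeClassesIn Φ _ _ hy.1) hy.2.2

/-- **Disjointness, element form**: `y ∈ Hdg^{l,q}(X, ℤ)`, `y ∈ T^l` `⟹` `y = 0`.
[cite: BrosnanFangNiePearlstein2009, §6 (6.1)] -/
theorem IsRiemannForm.eq_zero_of_mem_integralHodgeClassesIn_of_mem_integralHodgeAnnihilator (hη : IsRiemannForm Φ η)
    {y : E [⋀^Fin (2 * q)]→L[ℝ] ℂ} (hy : y ∈ integralHodgeClassesIn Φ (2 * q) q)
    (hyT : y ∈ integralForms Φ (2 * q) ⊓ ⨅ s : integralHodgeClassesIn Φ (2 * p) p,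
        (LinearMap.ker (poincarePairing Φ e h (s : E [⋀^Fin (2 * p)]→L[ℝ] ℂ))).toAddSubgroup) : y = 0 := by
  have hmem : y ∈ integralHodgeClassesIn Φ (2 * q) q ⊓ (integralForms Φ (2 * q) ⊓ ⨅ s : integralHodgeClassesIn Φ (2 * p) p,
      (LinearMap.ker (poincarePairing Φ e h (s : E [⋀^Fin (2 * p)]→L[ℝ] ℂ))).toAddSubgroup) := ⟨hy, hyT⟩
  rwa [hη.integralHodgeClassesIn_inf_integralHodgeAnnihilator_eq_bot Φ e hpq h, AddSubgroup.mem_bot] at hmem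

/-- **`B^{l,q}(X) ∩ ℚ·T^l = 0`**: no non-zero RATIONAL Hodge class of degree `2q` lies in the rational annihilator
`{y ∈ H^{2q}(X, ℚ) : ⟨Hdgᵖ(X, ℤ), y⟩ = 0} = ℚ · T^l` (g31-#11 `span_rat_integralHodgeAnnihilator_eq`).
[cite: BrosnanFangNiePearlstein2009, §6 (6.1)] [cite: Huybrechts2016K3, Ch. 3 Lemma 3.1] -/
theorem IsRiemannForm.hodgeClassesIn_inf_rationalAnnihilator_eq_bot (hη : IsRiemannForm Φ η) :
    hodgeClassesIn Φ (2 * q) q ⊓ (rationalForms Φ (2 * q) ⊓ ⨅ s : integralHodgeClassesIn Φ (2 * p) p,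
        (LinearMap.ker (poincarePairing Φ e h (s : E [⋀^Fin (2 * p)]→L[ℝ] ℂ))).restrictScalars ℚ) = ⊥ := by
  refine (Submodule.eq_bot_iff _).2 fun y hy ↦ ?_
  simp only [Submodule.mem_inf, Submodule.mem_iInf, Submodule.restrictScalars_mem, LinearMap.mem_ker, Subtype.forall] at hy
  exact hη.eq_zero_of_mem_hodgeClassesIn_of_forall_poincarePairing_eq_zero Φ e hpq h hy.1 hy.2.2

/-! ## §2 `rk Hdg^{l,q}(X, ℤ) + rk T^l = b_l(X)` -/

include e in
omit [DecidableEq ι] in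
/-- `rk_ℤ Hdgᵖ(X, ℤ) = rk_ℤ Hdg^{l,q}(X, ℤ)` on a polarised torus, in the `(2q, q)` spelling of this file: the tree's
`IsRiemannForm.finrank_integralHodgeClasses_eq_of_add_eq` (g31-#5, `ComplexTorusIntegralHardLefschetz`) with `dim_ℂ E = g` read
from `e : Fin (2g) ≃ ι`. [cite: Lange2023AbelianVarietiesComplex, §7.3.2 (1)] -/
private theorem IsRiemannForm.finrank_integralHodgeClassesIn_eq_of_add_eq (hη : IsRiemannForm Φ η) :
    finrank ℤ (integralHodgeClassesIn Φ (2 * p) p) = finrank ℤ (integralHodgeClassesIn Φ (2 * q) q) := by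
  haveI := finiteDimensional_real Φ e
  haveI : FiniteDimensional ℂ E := Module.Finite.of_restrictScalars_finite ℝ ℂ E
  have hg : finrank ℂ E = g := finrank_eq_of_finTwoMulEquiv Φ e
  exact hη.finrank_integralHodgeClasses_eq_of_add_eq Φ (hpq.trans hg.symm)

/-- **`rk_ℤ Hdg^{l,q}(X, ℤ) + rk_ℤ T^l = C(2g, l) = b_l(X)`** on a polarised torus: the Hodge lattice and the transcendental lattice
of the same even degree `l = 2q` have complementary ranks (`rk T^l = C(2g, l) − rk Hdg^{k,p}`, g31-#11, and `rk Hdg^{k,p} = rk Hdg^{l,q}`).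
[cite: Huybrechts2016K3, Ch. 3 §2.3 (PDF p. 59: "`NS(A)` … of rank `ρ(A)` … transcendental lattice … of rank `6 − ρ(A)`")] [cite: Lange2023AbelianVarietiesComplex, §7.3.2 (1) and §1.1.3 Exercise 1.1.6 (8)] -/
theorem IsRiemannForm.finrank_integralHodgeClassesIn_add_finrank_integralHodgeAnnihilator (hη : IsRiemannForm Φ η) :
    finrank ℤ (integralHodgeClassesIn Φ (2 * q) q) +
      finrank ℤ ↥(integralForms Φ (2 * q) ⊓ ⨅ s : integralHodgeClassesIn Φ (2 * p) p,
        (LinearMap.ker (poincarePairing Φ e h (s : E [⋀^Fin (2 * p)]→L[ℝ] ℂ))).toAddSubgroup) = (Fintype.card ι).choose (2 * q) := by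
  rw [← hη.finrank_integralHodgeClassesIn_eq_of_add_eq Φ e hpq, add_comm]
  exact finrank_integralHodgeAnnihilator_add_finrank_integralHodgeClassesIn Φ e h p

/-- The same with `b_l = C(2g, l)` read on `g`: `rk Hdg^{l,q}(X, ℤ) + rk T^l = C(2g, 2q)`.
[cite: Lange2023AbelianVarietiesComplex, §1.1.3 Exercise 1.1.6 (8)] -/
theorem IsRiemannForm.finrank_integralHodgeClassesIn_add_finrank_integralHodgeAnnihilator' (hη : IsRiemannForm Φ η) :
    finrank ℤ (integralHodgeClassesIn Φ (2 * q) q) +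
      finrank ℤ ↥(integralForms Φ (2 * q) ⊓ ⨅ s : integralHodgeClassesIn Φ (2 * p) p,
        (LinearMap.ker (poincarePairing Φ e h (s : E [⋀^Fin (2 * p)]→L[ℝ] ℂ))).toAddSubgroup) = (2 * g).choose (2 * q) := by
  rw [hη.finrank_integralHodgeClassesIn_add_finrank_integralHodgeAnnihilator Φ e hpq h, ← Fintype.card_congr e, Fintype.card_fin]

/-- **`Hˡ(X, ℚ) = B^{l,q}(X) ⊕ ℚ·T^l`**: the rational Hodge classes of degree `l = 2q` and the rational annihilator
`ℚ·T^l = {y ∈ Hˡ(X, ℚ) : ⟨Hdgᵖ(X, ℤ), y⟩ = 0}` of the integral Hodge classes of the complementary degree `2p` together SPAN the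
rational cohomology `Hˡ(X, ℚ)` (they meet in `0` by §1; dimensions `dim B^q + (b_l − dim Bᵖ) = b_l`).
[cite: BrosnanFangNiePearlstein2009, §6 (6.1)] [cite: VoisinHodgeI2002, §7.2 Lemma 7.26 (a sub-Hodge structure of a polarised Hodge structure has its orthogonal as a complement)] -/
theorem IsRiemannForm.hodgeClassesIn_sup_rationalAnnihilator_eq_rationalForms (hη : IsRiemannForm Φ η) :
    hodgeClassesIn Φ (2 * q) q ⊔ (rationalForms Φ (2 * q) ⊓ ⨅ s : integralHodgeClassesIn Φ (2 * p) p,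
        (LinearMap.ker (poincarePairing Φ e h (s : E [⋀^Fin (2 * p)]→L[ℝ] ℂ))).restrictScalars ℚ) = rationalForms Φ (2 * q) := by
  haveI := finiteDimensional_real Φ e
  haveI : FiniteDimensional ℂ E := Module.Finite.of_restrictScalars_finite ℝ ℂ E
  have hg : finrank ℂ E = g := finrank_eq_of_finTwoMulEquiv Φ e
  set A := (rationalForms Φ (2 * q) ⊓ ⨅ s : integralHodgeClassesIn Φ (2 * p) p,
    (LinearMap.ker (poincarePairing Φ e h (s : E [⋀^Fin (2 * p)]→L[ℝ] ℂ))).restrictScalars ℚ) with hA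
  have hAle : A ≤ rationalForms Φ (2 * q) := inf_le_left
  have hBle : hodgeClassesIn Φ (2 * q) q ≤ rationalForms Φ (2 * q) := fun y hy ↦ hy.1
  haveI : FiniteDimensional ℚ (hodgeClassesIn Φ (2 * q) q) := finiteDimensional_hodgeClassesIn Φ _ _
  haveI : FiniteDimensional ℚ A := finiteDimensional_of_le_rationalForms Φ hAle
  haveI : FiniteDimensional ℚ (rationalForms Φ (2 * q)) := finiteDimensional_rationalForms Φ _
  refine Submodule.eq_of_le_of_finrank_eq (sup_le hBle hAle) ?_
  have h1 := Submodule.finrank_sup_add_finrank_inf_eq (hodgeClassesIn Φ (2 * q) q) A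
  rw [hη.hodgeClassesIn_inf_rationalAnnihilator_eq_bot Φ e hpq h, finrank_bot, add_zero] at h1
  have h2 : finrank ℚ A + finrank ℚ (hodgeClassesIn Φ (2 * p) p) = (Fintype.card ι).choose (2 * q) :=
    finrank_rationalAnnihilator_add_finrank_hodgeClassesIn Φ e h p
  have h3 : finrank ℚ (hodgeClassesIn Φ (2 * p) p) = finrank ℚ (hodgeClassesIn Φ (2 * q) q) :=
    hη.finrank_hodgeClasses_eq_of_add_eq Φ (hpq.trans hg.symm)
  rw [h1, finrank_rationalForms_eq_choose]
  omega

/-! ## §3 `[Hˡ(X, ℤ) : Hdg^{l,q}(X, ℤ) ⊕ T^l]` is finite, `= |det (⟨sᵢ, tⱼ⟩)|` -/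

/-- The common package of §3 (g32-#4's surjection read in the `ℤ`-dual, its restriction `ψ` to `Hdg^{l,q}(X, ℤ)`, injective by
§1, and `Hdg^{l,q} ⊔ T^l = r⁻¹(ψ(Hdg^{l,q}))`). [cite: Huybrechts2016K3, Ch. 14 §0.2 (PDF p. 334)] -/
private theorem IsRiemannForm.exists_dualRestriction (hη : IsRiemannForm Φ η) :
    ∃ (r' : integralForms Φ (2 * q) →+ Module.Dual ℤ (integralHodgeClassesIn Φ (2 * p) p))
      (ψ : integralHodgeClassesIn Φ (2 * q) q →ₗ[ℤ] Module.Dual ℤ (integralHodgeClassesIn Φ (2 * p) p)),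
      (∀ (x : integralForms Φ (2 * q)) (s : integralHodgeClassesIn Φ (2 * p) p),
          ((r' x s : ℤ) : ℂ) = poincarePairing Φ e h (s : E [⋀^Fin (2 * p)]→L[ℝ] ℂ) (x : E [⋀^Fin (2 * q)]→L[ℝ] ℂ)) ∧
        Surjective r' ∧
        (∀ t : integralHodgeClassesIn Φ (2 * q) q, ψ t = r' ⟨(t : E [⋀^Fin (2 * q)]→L[ℝ] ℂ), t.2.1⟩) ∧ Injective ψ ∧
        (integralHodgeClassesIn Φ (2 * q) q ⊔ (integralForms Φ (2 * q) ⊓ ⨅ s : integralHodgeClassesIn Φ (2 * p) p,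
            (LinearMap.ker (poincarePairing Φ e h (s : E [⋀^Fin (2 * p)]→L[ℝ] ℂ))).toAddSubgroup)).addSubgroupOf
          (integralForms Φ (2 * q)) = ((LinearMap.range ψ).toAddSubgroup).comap r' := by
  classical
  have hHdH : integralHodgeClassesIn Φ (2 * q) q ≤ integralForms Φ (2 * q) := inf_le_left
  have hTH : (integralForms Φ (2 * q) ⊓ ⨅ s : integralHodgeClassesIn Φ (2 * p) p,
      (LinearMap.ker (poincarePairing Φ e h (s : E [⋀^Fin (2 * p)]→L[ℝ] ℂ))).toAddSubgroup) ≤ integralForms Φ (2 * q) :=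
    inf_le_left
  -- g32-#4: `r : Hˡ(X, ℤ) ↠ Hom(Hdgᵖ(X, ℤ), ℤ)` with kernel `T^l`
  obtain ⟨r, hr, hsurj, hker⟩ := exists_addMonoidHom_dual_integralHodgeClassesIn_surjective Φ e h p (k := 2 * p) (l := 2 * q)
  -- read in the `ℤ`-dual `Hom_ℤ(Hdgᵖ(X, ℤ), ℤ)`
  let ε : (integralHodgeClassesIn Φ (2 * p) p →+ ℤ) ≃ₗ[ℤ] Module.Dual ℤ (integralHodgeClassesIn Φ (2 * p) p) :=
    addMonoidHomLequivInt (B := ℤ) ℤ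
  let r' : integralForms Φ (2 * q) →+ Module.Dual ℤ (integralHodgeClassesIn Φ (2 * p) p) := ε.toAddMonoidHom.comp r
  have hr' : ∀ (x : integralForms Φ (2 * q)) (s : integralHodgeClassesIn Φ (2 * p) p),
      ((r' x s : ℤ) : ℂ) = poincarePairing Φ e h (s : E [⋀^Fin (2 * p)]→L[ℝ] ℂ) (x : E [⋀^Fin (2 * q)]→L[ℝ] ℂ) :=
    fun x s ↦ hr x s
  have hsurj' : Surjective r' := ε.surjective.comp hsurj
  have hker' : ∀ x : integralForms Φ (2 * q), r' x = 0 ↔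
      (x : E [⋀^Fin (2 * q)]→L[ℝ] ℂ) ∈ (integralForms Φ (2 * q) ⊓ ⨅ s : integralHodgeClassesIn Φ (2 * p) p,
        (LinearMap.ker (poincarePairing Φ e h (s : E [⋀^Fin (2 * p)]→L[ℝ] ℂ))).toAddSubgroup) := fun x ↦ by
    rw [show r' x = ε (r x) from rfl, ε.map_eq_zero_iff, ← AddMonoidHom.mem_ker, hker, AddSubgroup.mem_addSubgroupOf]
  -- `ψ = r|_{Hdg^{l,q}}`, injective by §1
  let ψ : integralHodgeClassesIn Φ (2 * q) q →ₗ[ℤ] Module.Dual ℤ (integralHodgeClassesIn Φ (2 * p) p) :=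
    r'.toIntLinearMap ∘ₗ (AddSubgroup.inclusion hHdH).toIntLinearMap
  have hψ : ∀ t : integralHodgeClassesIn Φ (2 * q) q, ψ t = r' ⟨(t : E [⋀^Fin (2 * q)]→L[ℝ] ℂ), t.2.1⟩ := fun t ↦ rfl
  have hψinj : Injective ψ := by
    refine (injective_iff_map_eq_zero ψ).2 fun t ht ↦ Subtype.ext ?_
    rw [hψ, hker'] at ht
    exact hη.eq_zero_of_mem_integralHodgeClassesIn_of_mem_integralHodgeAnnihilator Φ e hpq h t.2 ht
  refine ⟨r', ψ, hr', hsurj', hψ, hψinj, ?_⟩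
  -- `Hdg ⊔ T = r⁻¹(ψ(Hdg))`
  ext x
  rw [AddSubgroup.mem_addSubgroupOf, AddSubgroup.mem_comap, Submodule.mem_toAddSubgroup, LinearMap.mem_range]
  constructor
  · intro hx
    obtain ⟨a, ha, b, hb, hab⟩ := AddSubgroup.mem_sup.1 hx
    refine ⟨⟨a, ha⟩, ?_⟩
    have hxab : x = ⟨a, hHdH ha⟩ + ⟨b, hTH hb⟩ := Subtype.ext hab.symm
    rw [hψ, hxab, map_add, (hker' ⟨b, hTH hb⟩).2 hb, add_zero]
  · rintro ⟨t, ht⟩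
    rw [hψ] at ht
    have hdiff : (↑(x - ⟨(t : E [⋀^Fin (2 * q)]→L[ℝ] ℂ), t.2.1⟩) : E [⋀^Fin (2 * q)]→L[ℝ] ℂ) ∈
        (integralForms Φ (2 * q) ⊓ ⨅ s : integralHodgeClassesIn Φ (2 * p) p,
          (LinearMap.ker (poincarePairing Φ e h (s : E [⋀^Fin (2 * p)]→L[ℝ] ℂ))).toAddSubgroup) := by
      rw [← hker', map_sub, ← ht, sub_self]
    have hx : (x : E [⋀^Fin (2 * q)]→L[ℝ] ℂ) = (t : E [⋀^Fin (2 * q)]→L[ℝ] ℂ) +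
        (↑(x - ⟨(t : E [⋀^Fin (2 * q)]→L[ℝ] ℂ), t.2.1⟩) : E [⋀^Fin (2 * q)]→L[ℝ] ℂ) := by
      rw [AddSubgroup.coe_sub]; abel
    rw [hx]
    exact AddSubgroup.add_mem _ (AddSubgroup.mem_sup_left t.2) (AddSubgroup.mem_sup_right hdiff)

/-- **`Hdg^{l,q}(X, ℤ) ⊕ T^l ⊂ Hˡ(X, ℤ)` has FINITE INDEX on a polarised torus** (`l = 2q`; the relative index of the subgroup
`Hdg^{l,q}(X, ℤ) ⊔ T^l` in the lattice `Hˡ(X, ℤ)` is non-zero): under the surjection `r : Hˡ(X, ℤ) ↠ Hom(Hdgᵖ(X, ℤ), ℤ)`,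
`x ↦ ⟨·, x⟩`, with kernel `T^l` (g32-#4) the subgroup `Hdg^{l,q} ⊔ T^l` is the full preimage of `r(Hdg^{l,q})`, a sublattice of
full rank `rk Hdg^{l,q} = rk Hdgᵖ` of the dual lattice (`r` is injective on `Hdg^{l,q}` by §1).
[cite: Huybrechts2016K3, Ch. 14 §0.1–0.2 (PDF pp. 333–334: "`Λ₁ ⊕ Λ₂ ⊂ Λ` … of finite index", "the canonical maps `Λ^* → Λᵢ^*` are surjective")] [cite: BrosnanFangNiePearlstein2009, §6 (6.1)] -/
theorem IsRiemannForm.relIndex_integralHodgeClassesIn_sup_integralHodgeAnnihilator_ne_zero (hη : IsRiemannForm Φ η) :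
    (integralHodgeClassesIn Φ (2 * q) q ⊔ (integralForms Φ (2 * q) ⊓ ⨅ s : integralHodgeClassesIn Φ (2 * p) p,
        (LinearMap.ker (poincarePairing Φ e h (s : E [⋀^Fin (2 * p)]→L[ℝ] ℂ))).toAddSubgroup)).relIndex
      (integralForms Φ (2 * q)) ≠ 0 := by
  classical
  obtain ⟨r', ψ, -, hsurj', -, hψinj, hcomap⟩ := hη.exists_dualRestriction Φ e hpq h
  -- the dual lattice is free of rank `rk Hdgᵖ = rk Hdg^{l,q}`, and `ψ(Hdg^{l,q})` has that rank
  haveI := moduleFinite_integralHodgeClassesIn Φ (2 * p) p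
  haveI := moduleFree_integralHodgeClassesIn Φ (2 * p) p
  haveI := moduleFinite_integralHodgeClassesIn Φ (2 * q) q
  haveI := moduleFree_integralHodgeClassesIn Φ (2 * q) q
  let bk := Module.finBasis ℤ (integralHodgeClassesIn Φ (2 * p) p)
  haveI : Module.Free ℤ (Module.Dual ℤ (integralHodgeClassesIn Φ (2 * p) p)) := Module.Free.of_basis bk.dualBasis
  haveI : Module.Finite ℤ (Module.Dual ℤ (integralHodgeClassesIn Φ (2 * p) p)) := Module.Finite.of_basis bk.dualBasis
  have hrank : finrank ℤ (LinearMap.range ψ) = finrank ℤ (Module.Dual ℤ (integralHodgeClassesIn Φ (2 * p) p)) := by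
    rw [← (LinearEquiv.ofInjective ψ hψinj).finrank_eq, finrank_eq_card_basis bk.dualBasis, ← finrank_eq_card_basis bk,
      hη.finrank_integralHodgeClassesIn_eq_of_add_eq Φ e hpq]
  have hfin : Finite (Module.Dual ℤ (integralHodgeClassesIn Φ (2 * p) p) ⧸ (LinearMap.range ψ).toAddSubgroup) :=
    Submodule.finiteQuotientOfFreeOfRankEq _ hrank
  rw [AddSubgroup.relIndex, hcomap, AddSubgroup.index_comap_of_surjective _ hsurj']
  exact AddSubgroup.index_ne_zero_of_finite

/-- **The index formula `[Hˡ(X, ℤ) : Hdg^{l,q}(X, ℤ) ⊕ T^l] = |det M|`**, `M i j = ⟨sᵢ, tⱼ⟩`, for `ℤ`-bases `(sᵢ)_{i ∈ κ}` of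
`Hdgᵖ(X, ℤ) ⊂ H^{2p}(X, ℤ)` and `(tⱼ)_{j ∈ κ}` of `Hdg^{l,q}(X, ℤ) ⊂ H^{2q}(X, ℤ)` (`p + q = g`; such equinumerous bases exist by §2) and
the integer matrix `M` of their cup products: under `r : Hˡ(X, ℤ) ↠ Hom(Hdgᵖ(X, ℤ), ℤ)` (kernel `T^l`) the index of `Hdg^{l,q} ⊕ T^l`
is the index of the lattice spanned by the functionals `⟨·, tⱼ⟩` in the dual lattice with basis `sᵢ^*`, i.e. `|det (⟨sᵢ, tⱼ⟩)|`
(Huybrechts (0.1): "`disc Λ′ = disc Λ · (Λ : Λ′)²`" / "(Λ : Λ₁ ⊕ Λ₂)" read through Smith normal form, Mathlib's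
`AddSubgroup.index_eq_natAbs_det`). The middle degree `p = q` with `s = t` is g30-#4's `[H^{2p}(X, ℤ) : Hdg ⊕ T] = |disc Hdg|`
(Shioda–Mitani's "`|det S_X| = det T_X`" for `g = 2`). [cite: Huybrechts2016K3, Ch. 14 §0.1–0.2 (PDF pp. 333–334)] [cite: ShiodaMitani1974, §4 p. 172] [cite: Lange2023AbelianVarietiesComplex, §1.1.2 proof of Prop. 1.1.13 (c) (PDF p. 22: index = determinant)] -/
theorem IsRiemannForm.relIndex_integralHodgeClassesIn_sup_integralHodgeAnnihilator_eq_natAbs_det (hη : IsRiemannForm Φ η)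
    {κ : Type*} [Fintype κ] [DecidableEq κ] (s : Basis κ ℤ (integralHodgeClassesIn Φ (2 * p) p))
    (t : Basis κ ℤ (integralHodgeClassesIn Φ (2 * q) q)) (M : Matrix κ κ ℤ)
    (hM : ∀ i j, (M i j : ℂ) = poincarePairing Φ e h (s i : E [⋀^Fin (2 * p)]→L[ℝ] ℂ) (t j : E [⋀^Fin (2 * q)]→L[ℝ] ℂ)) :
    (integralHodgeClassesIn Φ (2 * q) q ⊔ (integralForms Φ (2 * q) ⊓ ⨅ s : integralHodgeClassesIn Φ (2 * p) p,
        (LinearMap.ker (poincarePairing Φ e h (s : E [⋀^Fin (2 * p)]→L[ℝ] ℂ))).toAddSubgroup)).relIndex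
      (integralForms Φ (2 * q)) = M.det.natAbs := by
  classical
  obtain ⟨r', ψ, hr', hsurj', hψ, hψinj, hcomap⟩ := hη.exists_dualRestriction Φ e hpq h
  -- bases: `sᵢ^*` of the dual lattice, `ψ(tⱼ)` of `ψ(Hdg^{l,q})`
  let bN : Basis κ ℤ (LinearMap.range ψ) := t.map (LinearEquiv.ofInjective ψ hψinj)
  have hbN : ∀ j, ((bN j : LinearMap.range ψ) : Module.Dual ℤ (integralHodgeClassesIn Φ (2 * p) p)) = ψ (t j) := fun j ↦ by
    rw [Basis.map_apply, LinearEquiv.ofInjective_apply]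
  rw [AddSubgroup.relIndex, hcomap, AddSubgroup.index_comap_of_surjective _ hsurj',
    AddSubgroup.index_eq_natAbs_det s.dualBasis (LinearMap.range ψ).toAddSubgroup bN, Basis.det_apply]
  congr 2
  ext i j
  rw [Basis.toMatrix_apply, Basis.dualBasis_repr]
  apply Int.cast_injective (α := ℂ)
  have h1 : ((bN j : LinearMap.range ψ) : Module.Dual ℤ (integralHodgeClassesIn Φ (2 * p) p)) (s i) =
      r' ⟨(t j : E [⋀^Fin (2 * q)]→L[ℝ] ℂ), (t j).2.1⟩ (s i) := by
    rw [hbN, hψ]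
  rw [hM i j, h1, hr']

/-- **Existence form**: on a polarised torus there are `ℤ`-bases `(sᵢ)`, `(tⱼ)` of `Hdgᵖ(X, ℤ)`, `Hdg^{l,q}(X, ℤ)` indexed by
`Fin ρ`, `ρ = rk Hdgᵖ(X, ℤ) = rk Hdg^{l,q}(X, ℤ)`, and for them (hence for any equinumerous bases) the integer matrix
`M i j = ⟨sᵢ, tⱼ⟩` of cup products satisfies `[Hˡ(X, ℤ) : Hdg^{l,q}(X, ℤ) ⊕ T^l] = |det M|` with `det M ≠ 0`.
[cite: Huybrechts2016K3, Ch. 14 §0.1–0.2 (PDF pp. 333–334)] [cite: ShiodaMitani1974, §4 p. 172] -/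
theorem IsRiemannForm.exists_basis_relIndex_integralHodgeClassesIn_sup_integralHodgeAnnihilator_eq_natAbs_det
    (hη : IsRiemannForm Φ η) :
    ∃ (s : Basis (Fin (finrank ℤ (integralHodgeClassesIn Φ (2 * p) p))) ℤ (integralHodgeClassesIn Φ (2 * p) p))
      (t : Basis (Fin (finrank ℤ (integralHodgeClassesIn Φ (2 * p) p))) ℤ (integralHodgeClassesIn Φ (2 * q) q))
      (M : Matrix (Fin (finrank ℤ (integralHodgeClassesIn Φ (2 * p) p))) (Fin (finrank ℤ (integralHodgeClassesIn Φ (2 * p) p))) ℤ),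
      (∀ i j, (M i j : ℂ) = poincarePairing Φ e h (s i : E [⋀^Fin (2 * p)]→L[ℝ] ℂ) (t j : E [⋀^Fin (2 * q)]→L[ℝ] ℂ)) ∧
        (integralHodgeClassesIn Φ (2 * q) q ⊔ (integralForms Φ (2 * q) ⊓ ⨅ s : integralHodgeClassesIn Φ (2 * p) p,
            (LinearMap.ker (poincarePairing Φ e h (s : E [⋀^Fin (2 * p)]→L[ℝ] ℂ))).toAddSubgroup)).relIndex
          (integralForms Φ (2 * q)) = M.det.natAbs ∧ M.det ≠ 0 := by
  classical
  haveI := moduleFinite_integralHodgeClassesIn Φ (2 * p) p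
  haveI := moduleFree_integralHodgeClassesIn Φ (2 * p) p
  haveI := moduleFinite_integralHodgeClassesIn Φ (2 * q) q
  haveI := moduleFree_integralHodgeClassesIn Φ (2 * q) q
  let s := Module.finBasis ℤ (integralHodgeClassesIn Φ (2 * p) p)
  let t : Basis (Fin (finrank ℤ (integralHodgeClassesIn Φ (2 * p) p))) ℤ (integralHodgeClassesIn Φ (2 * q) q) :=
    (Module.finBasis ℤ (integralHodgeClassesIn Φ (2 * q) q)).reindex
      (finCongr (hη.finrank_integralHodgeClassesIn_eq_of_add_eq Φ e hpq).symm)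
  -- the integer matrix of cup products
  have hint : ∀ i j, ∃ m : ℤ, poincarePairing Φ e h (s i : E [⋀^Fin (2 * p)]→L[ℝ] ℂ) (t j : E [⋀^Fin (2 * q)]→L[ℝ] ℂ) = m :=
    fun i j ↦ poincarePairing_mem_range_int Φ e h (s i).2.1 (t j).2.1
  choose m hm using hint
  have hdet := hη.relIndex_integralHodgeClassesIn_sup_integralHodgeAnnihilator_eq_natAbs_det Φ e hpq h s t (Matrix.of m)
    fun i j ↦ by rw [Matrix.of_apply, hm]
  refine ⟨s, t, Matrix.of m, fun i j ↦ by rw [Matrix.of_apply, hm], hdet, fun h0 ↦ ?_⟩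
  rw [h0, Int.natAbs_zero] at hdet
  exact hη.relIndex_integralHodgeClassesIn_sup_integralHodgeAnnihilator_ne_zero Φ e hpq h hdet

end PolarizedSplitting

end Literature.Geometry.Kaehler.ComplexTorus
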